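import Mathlib
import Summits.KontsevichZagierPeriods.Zeta5Search.BlockRatioBinomial
import Summits.KontsevichZagierPeriods.Zeta5Search.BrickTopCoefficient
import Literature.NumberTheory.LFunctions.GeneralizedBernoulliNumbers

/-!
# BrickLambda — the leading-coefficient ratio `λ_j = c_{j,A}(n)/c̃_{J,A}(N)` is a `p`-adic integer congruent to the
one-digit coefficient: `λ_j ≡ c_{j₀,A}(n₀) (mod p)` (zi-p2 THEOREM 6 Step E⁺ CLAIM, via the BLOCK-RATIO LEMMA;
cell zeta5-irr)

HONEST FRAMING: systematic search; no irrationality claim unless certified. INSTRUMENT lemma of the ζ(5)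
census cell zeta5-irr (HOME `run/shared/lean/pub/zeta5-irr/`; memo `zi-p2/probes/B8/thm6/THEOREM6.md` Step E⁺:
«Put `λ_j := c_{j,A}(n)/c̃_{j_1,A}(n_1)`. CLAIM: `λ_j ∈ ℤ_(p)` and `λ_j ≡ c_{j_0,A}(n_0) (mod p)`. Indeed `λ_j =
(−1)^{(n−n_1)B}·(n/2 − j)·[C(n,j)/C(n_1,j_1)]^A·[C(n+j,j)/C(n_1+j_1,j_1)]^B·[C(2n−j,n)/C(2n_1−j_1,n_1)]^B`, and the
BLOCK-RATIO LEMMA applies to all three ratios … [Lucas is NOT used: `C(n_1+j_1,j_1)` and `C(2n_1−j_1,n_1)` may be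
divisible by `p`.]»). Nothing here is about ζ(5); no irrationality content; filing moves no rung. Filed by the engine
seat zi-eng (g8); sequel of `BlockRatioBinomial` (zi-eng g7: `v_p(C(Np+b,Mp+d)) = v_p(C(N,M))`, unit parts
`≡ ·C(b,d) (mod p)`) and `BrickTopCoefficient` (`cTop`).

## The statement

`p` an odd prime; digits `n = n₀ + N·p`, `j = j₀ + J·p` with `j₀ ≤ n₀`, `n₀ + j₀ < p`, `n₀ + (n₀ − j₀) < p`, `J ≤ N`
(no hypothesis on `N`, `J` beyond that — `p` MAY divide `C(N,J)`, `C(N+J,J)`, `C(2N−J,N)`). Then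
* `choose_block_ratio`: `C((M+e)p + (d+f), Mp + d) = C(M+e, M)·(C(d+f, d) + t)` with `v_p(t) ≥ 1` (rational form of
  the block-ratio lemma), applied to `C(n,j)/C(N,J)`, `C(n+j,j)/C(N+J,J)`, `C(2n−j,n)/C(2N−J,N)`;
* **`cTop_eq_mul`**: `cTop A B ε n j = μ·cTop A B 0 N J` with an explicit `μ ∈ ℤ_(p)`,
  **`μ ≡ cTop A B ε n₀ j₀ (mod p)`** (`v_p(μ − c_{j₀,A}(n₀)) ≥ 1`);
* **`lambda_congr`**: any `λ` with `λ·cTop A B 0 N J = cTop A B ε n j` (e.g. the `λ` of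
  `BrickDigitStripMain.laurentSeries_rescale_eq`) satisfies `v_p(λ) ≥ 0` and `v_p(λ − cTop A B ε n₀ j₀) ≥ 1`.
-/

namespace Summit.KontsevichZagierPeriods.Zeta5Search.BrickLambda

open Finset Nat WithZero
open Summit.KontsevichZagierPeriods.Zeta5Search.BrickTopCoefficient (cTop)
open Summit.KontsevichZagierPeriods.Zeta5Search.BlockRatioBinomial (padicValNat_choose_block cast_choose_block_div)
open Literature.NumberTheory.LFunctions (padicValuation_natCast_le_one padicValuation_natCast_eq_one)

variable {p : ℕ} [Fact p.Prime]

/-! ## Congruence calculus in `ℤ_(p) ⊂ ℚ`: `x ≡ y :⇔ v(x − y) < 1` -/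

/-- `x ≡ y`, `y ∈ ℤ_(p)` ⇒ `x ∈ ℤ_(p)`. -/
theorem le_one_of_cong {x y : ℚ} (h : Rat.padicValuation p (x - y) < 1) (hy : Rat.padicValuation p y ≤ 1) :
    Rat.padicValuation p x ≤ 1 := by
  rw [show x = (x - y) + y by ring]
  exact (Valuation.map_add _ _ _).trans (max_le h.le hy)

/-- Products of congruences. -/
theorem cong_mul {x₁ y₁ x₂ y₂ : ℚ} (h₁ : Rat.padicValuation p (x₁ - y₁) < 1) (h₂ : Rat.padicValuation p (x₂ - y₂) < 1)
    (hx₁ : Rat.padicValuation p x₁ ≤ 1) (hy₂ : Rat.padicValuation p y₂ ≤ 1) :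
    Rat.padicValuation p (x₁ * x₂ - y₁ * y₂) < 1 := by
  rw [show x₁ * x₂ - y₁ * y₂ = x₁ * (x₂ - y₂) + (x₁ - y₁) * y₂ by ring]
  refine (Valuation.map_add _ _ _).trans_lt (max_lt ?_ ?_)
  · rw [map_mul]; exact (mul_le_mul' hx₁ le_rfl).trans_lt (by rwa [one_mul])
  · rw [map_mul]; exact (mul_le_mul' le_rfl hy₂).trans_lt (by rwa [mul_one])

/-- Powers of congruences. -/
theorem cong_pow {x y : ℚ} (h : Rat.padicValuation p (x - y) < 1) (hx : Rat.padicValuation p x ≤ 1)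
    (hy : Rat.padicValuation p y ≤ 1) (k : ℕ) : Rat.padicValuation p (x ^ k - y ^ k) < 1 := by
  induction k with
  | zero => rw [pow_zero, pow_zero, sub_self, map_zero]; exact zero_lt_one
  | succ k ih =>
    rw [pow_succ, pow_succ]
    exact cong_mul ih h (by rw [map_pow]; exact pow_le_one' hx k) hy

/-! ## The block-ratio lemma in rational form -/

/-- **`C((M+e)p + (d+f), Mp + d) = C(M+e, M)·(C(d+f, d) + t)`, `v_p(t) ≥ 1`** (`d + f < p`), from the valuation and
unit-part halves of `BlockRatioBinomial`. -/
theorem choose_block_ratio (M e : ℕ) {d f : ℕ} (hdf : d + f < p) :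
    ∃ t : ℚ, Rat.padicValuation p t < 1 ∧
      ((((M + e) * p + (d + f)).choose (M * p + d) : ℕ) : ℚ) =
        (((M + e).choose M : ℕ) : ℚ) * ((((d + f).choose d : ℕ) : ℚ) + t) := by
  have hp : p.Prime := Fact.out
  set Cb := ((M + e) * p + (d + f)).choose (M * p + d) with hCb
  set Y := (M + e).choose M with hY
  set v := padicValNat p Y with hv
  have hvC : padicValNat p Cb = v := padicValNat_choose_block hp M e hdf
  have hCb0 : Cb ≠ 0 := (Nat.choose_pos (by nlinarith)).ne'
  have hY0 : Y ≠ 0 := (Nat.choose_pos (Nat.le_add_right M e)).ne'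
  obtain ⟨c, hc⟩ : p ^ v ∣ Cb := by rw [← hvC]; exact pow_padicValNat_dvd
  obtain ⟨y, hy⟩ : p ^ v ∣ Y := pow_padicValNat_dvd
  have hpv : 0 < p ^ v := pow_pos hp.pos v
  have hcdiv : Cb / p ^ padicValNat p Cb = c := by rw [hvC, hc, Nat.mul_div_cancel_left _ hpv]
  have hydiv : Y / p ^ padicValNat p Y = y := by rw [← hv, hy, Nat.mul_div_cancel_left _ hpv]
  -- `y` is prime to `p`
  have hyp : ¬ p ∣ y := by
    intro h
    have h1 : p ^ (v + 1) ∣ Y := by rw [hy, pow_succ]; exact Nat.mul_dvd_mul_left _ h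
    have h2 := (padicValNat_dvd_iff_le hY0).1 h1
    omega
  have hy0 : y ≠ 0 := fun h => hyp (by rw [h]; exact dvd_zero p)
  have hyQ : (y : ℚ) ≠ 0 := by exact_mod_cast hy0
  -- the unit parts mod `p`
  have hz := cast_choose_block_div hp M e hdf
  rw [← hCb, ← hY, hcdiv, hydiv] at hz
  have hdvd : (p : ℤ) ∣ (c : ℤ) - y * ((d + f).choose d : ℕ) := by
    rw [← ZMod.intCast_zmod_eq_zero_iff_dvd]
    push_cast
    rw [hz]; ring
  refine ⟨((c : ℚ) - y * ((d + f).choose d : ℕ)) / y, ?_, ?_⟩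
  · rw [map_div₀, padicValuation_natCast_eq_one hyp, div_one,
      show ((c : ℚ) - y * ((d + f).choose d : ℕ)) = (((c : ℤ) - y * ((d + f).choose d : ℕ) : ℤ) : ℚ) by push_cast; ring,
      Rat.padicValuation_cast, Int.padicValuation_lt_one_iff]
    exact hdvd
  · rw [hc, hy]
    push_cast
    field_simp
    ring

/-! ## `λ_j ≡ c_{j₀,A}(n₀) (mod p)` -/

section lambda

/-- `v_p(2) = 0` for odd `p`. -/
theorem padicValuation_two (hp2 : p ≠ 2) : Rat.padicValuation p (2 : ℚ) = 1 := by
  have hp : p.Prime := Fact.out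
  rw [show (2 : ℚ) = ((2 : ℕ) : ℚ) by norm_num]
  exact padicValuation_natCast_eq_one fun h => hp2 ((Nat.prime_dvd_prime_iff_eq hp Nat.prime_two).1 h)

omit [Fact p.Prime] in
/-- The top coefficient of the symmetric kernel is nonzero: `cTop A B 0 N J ≠ 0` (`J ≤ N`). -/
theorem cTop_zero_ne_zero {N J : ℕ} (hJN : J ≤ N) (A B : ℕ) : cTop A B 0 N J ≠ 0 := by
  unfold cTop
  rw [pow_zero, mul_one]
  refine mul_ne_zero (mul_ne_zero (pow_ne_zero _ (by norm_num)) (pow_ne_zero _ ?_)) (pow_ne_zero _ (mul_ne_zero ?_ ?_))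
  · exact_mod_cast (Nat.choose_pos hJN).ne'
  · exact_mod_cast (Nat.choose_pos (Nat.le_add_left J N)).ne'
  · exact_mod_cast (Nat.choose_pos (by omega : N ≤ 2 * N - J)).ne'

variable (hp2 : p ≠ 2) {A B ε N n₀ J j₀ : ℕ} (hj₀ : j₀ ≤ n₀) (h1 : n₀ + j₀ < p) (h2 : n₀ + (n₀ - j₀) < p)
  (hJN : J ≤ N)
include hp2 hj₀ h1 h2 hJN

/-- **`c_{j,A}(n) = μ·c̃_{J,A}(N)` with `μ ∈ ℤ_(p)`, `μ ≡ c_{j₀,A}(n₀) (mod p)`** for `n = n₀ + Np`, `j = j₀ + Jp` in the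
main digit range (`j₀ ≤ n₀`, `n₀ + j₀ < p`, `n₀ + (n₀ − j₀) < p`, `J ≤ N`; odd `p`). -/
theorem cTop_eq_mul : ∃ μ : ℚ, Rat.padicValuation p μ ≤ 1 ∧ Rat.padicValuation p (μ - cTop A B ε n₀ j₀) < 1 ∧
    cTop A B ε (n₀ + N * p) (j₀ + J * p) = μ * cTop A B 0 N J := by
  have hp : p.Prime := Fact.out
  -- the three block ratios
  obtain ⟨t₁, ht₁, e₁⟩ := choose_block_ratio (p := p) J (N - J) (d := j₀) (f := n₀ - j₀) (by omega)
  obtain ⟨t₂, ht₂, e₂⟩ := choose_block_ratio (p := p) J N (d := j₀) (f := n₀) (by omega)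
  obtain ⟨t₃, ht₃, e₃⟩ := choose_block_ratio (p := p) N (N - J) (d := n₀) (f := n₀ - j₀) (by omega)
  -- rewrite the big binomials of `cTop ε n j` in block form
  have eb₁ : (n₀ + N * p).choose (j₀ + J * p) = ((J + (N - J)) * p + (j₀ + (n₀ - j₀))).choose (J * p + j₀) := by
    congr 1 <;> [skip; ring]; rw [show J + (N - J) = N by omega, show j₀ + (n₀ - j₀) = n₀ by omega]; ring
  have eb₂ : (n₀ + N * p + (j₀ + J * p)).choose (j₀ + J * p) = ((J + N) * p + (j₀ + n₀)).choose (J * p + j₀) := by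
    congr 1 <;> ring
  have eb₃ : (2 * (n₀ + N * p) - (j₀ + J * p)).choose (n₀ + N * p) =
      ((N + (N - J)) * p + (n₀ + (n₀ - j₀))).choose (N * p + n₀) := by
    congr 1
    · zify [hj₀, hJN, show j₀ + J * p ≤ 2 * (n₀ + N * p) by nlinarith]
      ring
    · ring
  have es₁ : (J + (N - J)).choose J = N.choose J := by rw [show J + (N - J) = N by omega]
  have es₂ : (J + N).choose J = (N + J).choose J := by rw [add_comm]
  have es₃ : (N + (N - J)).choose N = (2 * N - J).choose N := by rw [show N + (N - J) = 2 * N - J by omega]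
  have ec₁ : (j₀ + (n₀ - j₀)).choose j₀ = n₀.choose j₀ := by rw [show j₀ + (n₀ - j₀) = n₀ by omega]
  have ec₂ : (j₀ + n₀).choose j₀ = (n₀ + j₀).choose j₀ := by rw [add_comm]
  have ec₃ : (n₀ + (n₀ - j₀)).choose n₀ = (2 * n₀ - j₀).choose n₀ := by rw [show n₀ + (n₀ - j₀) = 2 * n₀ - j₀ by omega]
  rw [es₁, ec₁] at e₁
  rw [es₂, ec₂] at e₂
  rw [es₃, ec₃] at e₃
  -- the candidate `μ`
  set r₁ : ℚ := (n₀.choose j₀ : ℚ) + t₁ with hr₁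
  set r₂ : ℚ := ((n₀ + j₀).choose j₀ : ℚ) + t₂ with hr₂
  set r₃ : ℚ := ((2 * n₀ - j₀).choose n₀ : ℚ) + t₃ with hr₃
  set cen : ℚ := ((n₀ + N * p : ℕ) : ℚ) / 2 - ((j₀ + J * p : ℕ) : ℚ) with hcen_def
  refine ⟨(-1) ^ (n₀ * B + j₀ * A) * cen ^ ε * r₁ ^ A * (r₂ * r₃) ^ B, ?_, ?_, ?_⟩
  · -- integrality (from the congruence below it would also follow; direct)
    have hr : ∀ {c : ℕ} {t : ℚ}, Rat.padicValuation p t < 1 → Rat.padicValuation p ((c : ℚ) + t) ≤ 1 :=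
      fun {c t} ht => (Valuation.map_add _ _ _).trans (max_le (padicValuation_natCast_le_one _) ht.le)
    have hcen : Rat.padicValuation p cen ≤ 1 := by
      rw [show cen = ((((n₀ + N * p : ℕ) : ℤ) - 2 * ((j₀ + J * p : ℕ) : ℤ) : ℤ) : ℚ) / 2 by rw [hcen_def]; push_cast; ring,
        map_div₀,
        padicValuation_two hp2, div_one, Rat.padicValuation_cast]
      exact Int.padicValuation_le_one _ _
    rw [map_mul, map_mul, map_mul, map_pow, Valuation.map_neg, map_one, one_pow, one_mul, map_pow, map_pow, map_pow,
      map_mul]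
    exact mul_le_one' (mul_le_one' (pow_le_one' hcen _) (pow_le_one' (hr ht₁) _))
      (pow_le_one' (mul_le_one' (hr ht₂) (hr ht₃)) _)
  · -- the congruence `μ ≡ cTop ε n₀ j₀`
    have hr : ∀ {c : ℕ} {t : ℚ}, Rat.padicValuation p t < 1 → Rat.padicValuation p ((c : ℚ) + t - c) < 1 :=
      fun {c t} ht => by rwa [add_sub_cancel_left]
    have hrle : ∀ {c : ℕ} {t : ℚ}, Rat.padicValuation p t < 1 → Rat.padicValuation p ((c : ℚ) + t) ≤ 1 :=
      fun {c t} ht => (Valuation.map_add _ _ _).trans (max_le (padicValuation_natCast_le_one _) ht.le)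
    have hcen0 : Rat.padicValuation p ((n₀ : ℚ) / 2 - j₀) ≤ 1 := by
      rw [show (n₀ : ℚ) / 2 - j₀ = (((n₀ : ℤ) - 2 * j₀ : ℤ) : ℚ) / 2 by push_cast; ring, map_div₀,
        padicValuation_two hp2, div_one, Rat.padicValuation_cast]
      exact Int.padicValuation_le_one _ _
    have hcen : Rat.padicValuation p (cen - ((n₀ : ℚ) / 2 - j₀)) < 1 := by
      rw [show cen - ((n₀ : ℚ) / 2 - j₀) = (p : ℚ) * ((((N : ℤ) - 2 * J : ℤ)) : ℚ) / 2 by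
        rw [hcen_def]; push_cast; ring, map_div₀, padicValuation_two hp2, div_one, map_mul,
        Rat.padicValuation_self, Rat.padicValuation_cast]
      calc exp (-1 : ℤ) * Int.padicValuation p ((N : ℤ) - 2 * J) ≤ exp (-1 : ℤ) * 1 :=
            mul_le_mul' le_rfl (Int.padicValuation_le_one _ _)
        _ < 1 := by rw [mul_one, ← exp_zero, exp_lt_exp]; norm_num
    have hcenle : Rat.padicValuation p cen ≤ 1 := le_one_of_cong hcen hcen0
    have hs1 : Rat.padicValuation p ((-1 : ℚ) ^ (n₀ * B + j₀ * A)) ≤ 1 := by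
      rw [map_pow, Valuation.map_neg, map_one, one_pow]
    have hs : Rat.padicValuation p ((-1 : ℚ) ^ (n₀ * B + j₀ * A) - (-1) ^ (n₀ * B + j₀ * A)) < 1 := by
      rw [sub_self, map_zero]; exact zero_lt_one
    have hC : ∀ c : ℕ, Rat.padicValuation p (c : ℚ) ≤ 1 := fun c => padicValuation_natCast_le_one c
    unfold cTop
    refine cong_mul (cong_mul (cong_mul hs (cong_pow hcen hcenle hcen0 ε) hs1 (by rw [map_pow]; exact pow_le_one' hcen0 _))
      (cong_pow (hr ht₁) (hrle ht₁) (hC _) A) ?_ (by rw [map_pow]; exact pow_le_one' (hC _) _)) ?_ ?_ ?_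
    · rw [map_mul]; exact mul_le_one' hs1 (by rw [map_pow]; exact pow_le_one' hcenle _)
    · exact cong_pow (cong_mul (hr ht₂) (hr ht₃) (hrle ht₂) (hC _)) (by rw [map_mul]; exact mul_le_one' (hrle ht₂) (hrle ht₃))
        (by rw [map_mul]; exact mul_le_one' (hC _) (hC _)) B
    · rw [map_mul, map_mul]
      exact mul_le_one' (mul_le_one' hs1 (by rw [map_pow]; exact pow_le_one' hcenle _))
        (by rw [map_pow]; exact pow_le_one' (hrle ht₁) _)
    · rw [map_pow, map_mul]
      exact pow_le_one' (mul_le_one' (hC _) (hC _)) _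
  · -- the identity
    have hsign : ((-1 : ℚ)) ^ ((n₀ + N * p) * B + (j₀ + J * p) * A) = (-1) ^ (n₀ * B + j₀ * A) * (-1) ^ (N * B + J * A) := by
      have hodd : Odd p := hp.odd_of_ne_two hp2
      rw [show (n₀ + N * p) * B + (j₀ + J * p) * A = (n₀ * B + j₀ * A) + (N * B + J * A) + (p - 1) * (N * B + J * A) by
        zify [hp.one_le]; ring, pow_add, pow_add, pow_mul, (Nat.Odd.sub_odd hodd odd_one).neg_one_pow, one_pow, mul_one]
    unfold cTop
    rw [eb₁, eb₂, eb₃, e₁, e₂, e₃, hsign, pow_zero, mul_one, hcen_def]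
    ring

/-- **`λ_j ∈ ℤ_(p)` and `λ_j ≡ c_{j₀,A}(n₀) (mod p)`** for any `λ` with `λ·c̃_{J,A}(N) = c_{j,A}(n)` — e.g. the `λ` of
`BrickDigitStripMain.laurentSeries_rescale_eq` (there `λ·laurent A B 0 N J 0 = laurent A B ε n j 0`, and
`laurent … 0 = cTop …` by `BrickLaurent.laurent_zero`). -/
theorem lambda_congr {lam : ℚ} (hlam : lam * cTop A B 0 N J = cTop A B ε (n₀ + N * p) (j₀ + J * p)) :
    Rat.padicValuation p lam ≤ 1 ∧ Rat.padicValuation p (lam - cTop A B ε n₀ j₀) < 1 := by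
  obtain ⟨μ, hμ, hμc, hμeq⟩ := cTop_eq_mul (p := p) hp2 (A := A) (B := B) (ε := ε) hj₀ h1 h2 hJN
  have h0 := cTop_zero_ne_zero hJN A B
  have : lam = μ := mul_right_cancel₀ h0 (by rw [hlam, hμeq])
  subst this
  exact ⟨hμ, hμc⟩

end lambda

end Summit.KontsevichZagierPeriods.Zeta5Search.BrickLambda
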